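/-
Copyright (c) 2026 the pub-hodgecm-mathlib formalisation cell (harness21).  Prover seat hodgecm-mathlib-K2E4-p11 (g9): Track B «K2-LIT»,
hLiu418 = stmt-HodgeConjecture-24832, socket #41 KIND W, organ «Φ6b-ind» FILE 3a (LEAD F0P6-plan (g14) BATCH #178 (1), KW desk F0P2-p08 (g3)):
INTEGRABILITY OF THE CAYLEY TERMS — the entry bound `‖(g − ix)_{kl}‖ ≤ (tr g ∕ det g)·|det(g − ix)|` and the majorant `‖Φ_{α,β}‖` for every
integration-by-parts term of the ξ-recursion.
THEOREMS ONLY (no `def`, no `instance`, no `notation`, no named-fact hypothesis, no `sorry`).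
-/
import Summits.HodgeConjecture.HodgeConjecture.Theorems.K2LiuHermTwoXiIntegrandLineDeriv   -- ★ FILE 2a (this seat): index shifts, `xiTwoIntegrand_eq_cexp_mul_zero`
import HarnessLib

/-!
# Crux `HLiu418`, ROAD Φ ∕ KIND W organ «Φ6b-ind», FILE 3a: INTEGRABILITY of the Cayley ∕ integration-by-parts terms of the ξ-recursion

Cell `hodgecm-mathlib`, crux item hLiu418 = `stmt-HodgeConjecture-24832` (helper lane `--supports … --as helper`, count-neutral), route of record
`HCCMUnconditional`; squad K2 ∕ K2Liu, road `K2_Liu`, socket #41, KIND W.  Sequel of ★ FILE 2a∕2b (`K2LiuHermTwoXiIntegrandLineDeriv`,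
`K2LiuHermTwoXiIntegrandCayley`).  FILE 3b integrates the Cayley identity by parts on `Herm₂(ℂ) ≅ ℝ × ℂ × ℝ`; Mathlib's
`integral_bilinear_hasLineDerivAt_right_eq_neg_left_of_integrable` wants every product `f·g′`, `f′·g`, `f·g` integrable.  THIS FILE supplies those
integrabilities from ONE majorant: for `g > 0`, `h` Hermitian and `re(α+β) > 3`, every term is `≤ K·‖xiTwoIntegrand g h α β‖` pointwise
(★ `integrable_xiTwoIntegrand`), because
* §1 **`‖(g − ix)_{kl}‖ ≤ C_g·|det(g − ix)|`** with `C_g = tr g ∕ det g` (`norm_entry_le_mul_norm_det_sub_I_smul`): for `Y = g − ix` and the columns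
  `u = (Y₁₁, −Y₁₀)`, `u′ = (−Y₀₁, Y₀₀)` of `adj Y` one has `Y u = (det Y, 0)`, `Y u′ = (0, det Y)`, while `Re(u* Y u) = u* g u ≥ λ‖u‖²`
  (`λ = det g ∕ tr g ≤ λ_min(g)`; `u* x u` is real) and `Re(u* Y u) ≤ ‖u₀‖·|det Y|`; the `+` version by `(g + ix)_{kl} = conj (g − ix)_{lk}`;
* §2 hence the polarisation coefficients `tr(adj(g ∓ ix)·M)` of ★ FILE 2a are `≤ C_g·(Σ‖M_{kl}‖)·|det(g ∓ ix)|`, and the index shifts divide by exactly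
  these determinants: `xiTwoIntegrand g h (α+1) β = −det(g − ix)⁻¹ · xiTwoIntegrand g h α β` (§2 `xiTwoIntegrand_succ_left∕right`);
* §3 the integrability of `tr(adj(Y)M)·ξ-integrand(α+1,β)`, `tr(adj(W)M)·ξ-integrand(α,β+1)` and of the three second-order products
  (`(α+2,β)`, `(α+1,β+1)`, `(α,β+2)`) — the complete list of `Φ`-side factors of the six integrations by parts of FILE 3b.
[Shimura1982, §1 (1.25), §3] [Shimura1997, §16.4].
HONEST LABEL.  Count-neutral helper of the K2_Liu road; it pays no socket by itself: `HC_CM` is proved only modulo the 7 printed citations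
(2 remaining named inputs: hLiu418 = `stmt-HodgeConjecture-24832`, h413 = `stmt-HodgeConjecture-24833`) until rung 0 closes.

## References
* [Shimura1982] G. Shimura, *Confluent hypergeometric functions on tube domains*, Math. Ann. 260 (1982) 269–302: §1 (1.25), §3.
* [Shimura1997] G. Shimura, *Euler Products and Eisenstein Series*, CBMS 93 (1997): §16.4.
-/

set_option autoImplicit false
-- the mandated namespace repeats the single-problem summit's segment (`HodgeConjecture.HodgeConjecture`)
set_option linter.dupNamespace false

noncomputable section

open Complex MeasureTheory Set
open scoped ComplexOrder ComplexConjugate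

namespace Summit.HodgeConjecture.HodgeConjecture.Cruxes.HLiu418.K2LiuHermTwoXiCayleyIntegrability

open Summit.HodgeConjecture.HodgeConjecture.Cruxes.HLiu418.K2LiuHermTwoGammaDefs
open Summit.HodgeConjecture.HodgeConjecture.Cruxes.HLiu418.K2LiuHermTwoDetPowerIntegrable
open Summit.HodgeConjecture.HodgeConjecture.Cruxes.HLiu418.K2LiuHermTwoConfluentXiDefs
open Summit.HodgeConjecture.HodgeConjecture.Cruxes.HLiu418.K2LiuHermTwoConfluentXiConvergence
open Summit.HodgeConjecture.HodgeConjecture.Cruxes.HLiu418.K2LiuHermTwoEtaDefs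
open Summit.HodgeConjecture.HodgeConjecture.Cruxes.HLiu418.K2LiuHermTwoXiIntegrandLineDeriv

/-! ## §1 The entry bound `‖(g − ix)_{kl}‖ ≤ (tr g ∕ det g) · |det(g − ix)|` -/

/-- The Hermitian form of `g = [[p,w],[w̄,q]] > 0` dominates `λ·‖u‖²` with `λ = det g ∕ tr g`:
`(pq − |w|²)∕(p + q) · (‖u₀‖² + ‖u₁‖²) ≤ p‖u₀‖² + q‖u₁‖² + 2 Re(ū₀ w u₁)` (sum of two squares). [folklore] -/
theorem quadForm_lower_bound {p q : ℝ} {w : ℂ} (hp : 0 < p) (hw : normSq w < p * q) (u₀ u₁ : ℂ) :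
    (p * q - normSq w) / (p + q) * (‖u₀‖ ^ 2 + ‖u₁‖ ^ 2) ≤ p * ‖u₀‖ ^ 2 + q * ‖u₁‖ ^ 2 + 2 * (conj u₀ * w * u₁).re := by
  have hq : 0 < q := (mul_pos_iff_of_pos_left hp).mp (lt_of_le_of_lt (normSq_nonneg w) hw)
  have hpq : 0 < p + q := by linarith
  have hm : normSq w = ‖w‖ ^ 2 := Complex.normSq_eq_norm_sq w
  have hRe : -(‖u₀‖ * ‖w‖ * ‖u₁‖) ≤ (conj u₀ * w * u₁).re := by
    have h1 := Complex.abs_re_le_norm (conj u₀ * w * u₁)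
    rw [norm_mul, norm_mul, Complex.norm_conj] at h1
    linarith [neg_abs_le (conj u₀ * w * u₁).re]
  rw [div_mul_eq_mul_div, div_le_iff₀ hpq, hm]
  have h0 : 0 ≤ ((conj u₀ * w * u₁).re + ‖u₀‖ * ‖w‖ * ‖u₁‖) * (p + q) := mul_nonneg (by linarith) hpq.le
  nlinarith [sq_nonneg (p * ‖u₀‖ - ‖w‖ * ‖u₁‖), sq_nonneg (q * ‖u₁‖ - ‖w‖ * ‖u₀‖), norm_nonneg u₀, norm_nonneg u₁, norm_nonneg w]

/-- The REAL PART of `u*·(g − ix)·u` is the Hermitian form of `g` (`u* x u` is real): for `Y = hermTwo d − i·hermTwo c`,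
`Re(ū₀(Y₀₀u₀ + Y₀₁u₁) + ū₁(Y₁₀u₀ + Y₁₁u₁)) = p‖u₀‖² + q‖u₁‖² + 2Re(ū₀ w u₁)`. [folklore] -/
theorem re_inner_sub_I_smul (d c : ℝ × ℂ × ℝ) (u₀ u₁ : ℂ) :
    (conj u₀ * ((hermTwo d - I • hermTwo c) 0 0 * u₀ + (hermTwo d - I • hermTwo c) 0 1 * u₁) +
        conj u₁ * ((hermTwo d - I • hermTwo c) 1 0 * u₀ + (hermTwo d - I • hermTwo c) 1 1 * u₁)).re =
      d.1 * ‖u₀‖ ^ 2 + d.2.2 * ‖u₁‖ ^ 2 + 2 * (conj u₀ * d.2.1 * u₁).re := by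
  simp only [Matrix.sub_apply, Matrix.smul_apply, smul_eq_mul, hermTwo_apply_zero_zero, hermTwo_apply_zero_one, hermTwo_apply_one_zero,
    hermTwo_apply_one_one, Complex.sq_norm, Complex.normSq_apply]
  simp only [Complex.add_re, Complex.sub_re, Complex.mul_re, Complex.mul_im, Complex.add_im, Complex.sub_im, Complex.conj_re, Complex.conj_im,
    Complex.I_re, Complex.I_im, Complex.ofReal_re, Complex.ofReal_im]
  ring

/-- **THE ENTRY BOUND IN COORDINATES**: for `g = hermTwo d > 0` (`0 < p`, `|w|² < pq`) and every Hermitian `x = hermTwo c`,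
`‖(g − ix)_{kl}‖ ≤ (p + q)∕(pq − |w|²) · |det(g − ix)|` for all `k, l`. [folklore] -/
theorem norm_entry_le_mul_norm_det_hermTwo (d : ℝ × ℂ × ℝ) (hd : 0 < d.1 ∧ normSq d.2.1 < d.1 * d.2.2) (c : ℝ × ℂ × ℝ) (i j : Fin 2) :
    ‖(hermTwo d - I • hermTwo c) i j‖ ≤ (d.1 + d.2.2) / (d.1 * d.2.2 - normSq d.2.1) * ‖(hermTwo d - I • hermTwo c).det‖ := by
  obtain ⟨hp, hw⟩ := hd
  have hq : 0 < d.2.2 := (mul_pos_iff_of_pos_left hp).mp (lt_of_le_of_lt (normSq_nonneg _) hw)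
  set Y : Matrix (Fin 2) (Fin 2) ℂ := hermTwo d - I • hermTwo c with hY
  set lam : ℝ := (d.1 * d.2.2 - normSq d.2.1) / (d.1 + d.2.2) with hlam
  set C : ℝ := (d.1 + d.2.2) / (d.1 * d.2.2 - normSq d.2.1) with hC
  set D : ℝ := ‖Y.det‖ with hD
  have hδ : 0 < d.1 * d.2.2 - normSq d.2.1 := by linarith
  have hlam0 : 0 < lam := div_pos hδ (by linarith)
  have hC0 : 0 < C := div_pos (by linarith) hδ
  have hClam : C * lam = 1 := by rw [hC, hlam]; field_simp
  have hD0 : 0 ≤ D := norm_nonneg _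
  have hdet : Y.det = Y 0 0 * Y 1 1 - Y 0 1 * Y 1 0 := Matrix.det_fin_two Y
  -- from `λ s² ≤ s D` to `s ≤ C D`, and from `λ t² ≤ s D ≤ …` to `t ≤ C D`
  have step : ∀ s t : ℝ, 0 ≤ s → 0 ≤ t → lam * (s ^ 2 + t ^ 2) ≤ s * D → s ≤ C * D ∧ t ≤ C * D := by
    intro s t hs ht h
    have hs' : s ≤ C * D := by
      by_cases hs0 : s = 0
      · rw [hs0]; positivity
      · have hspos : 0 < s := lt_of_le_of_ne hs (Ne.symm hs0)
        have h1 : lam * s ^ 2 ≤ s * D := by nlinarith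
        have h2 : lam * s ≤ D := by
          have := div_le_div_of_nonneg_right h1 hspos.le
          nlinarith [this]
        calc s = C * (lam * s) := by rw [← mul_assoc, hClam, one_mul]
          _ ≤ C * D := mul_le_mul_of_nonneg_left h2 hC0.le
    refine ⟨hs', ?_⟩
    have h3 : lam * t ^ 2 ≤ C * D * D := by nlinarith
    have h4 : t ^ 2 ≤ (C * D) ^ 2 := by
      have : t ^ 2 = C * (lam * t ^ 2) := by rw [← mul_assoc, hClam, one_mul]
      rw [this]
      nlinarith [mul_le_mul_of_nonneg_left h3 hC0.le]
    exact (pow_le_pow_iff_left₀ ht (by positivity) two_ne_zero).mp h4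
  -- column `u = (Y₁₁, −Y₁₀)`: `Y u = (det Y, 0)`
  have hcol1 : conj (Y 1 1) * (Y 0 0 * Y 1 1 + Y 0 1 * (-Y 1 0)) + conj (-Y 1 0) * (Y 1 0 * Y 1 1 + Y 1 1 * (-Y 1 0)) = conj (Y 1 1) * Y.det := by
    rw [hdet]; ring
  have hq1 := quadForm_lower_bound hp hw (Y 1 1) (-Y 1 0)
  have hre1 := re_inner_sub_I_smul d c (Y 1 1) (-Y 1 0)
  rw [← hY] at hre1
  rw [← hre1, hcol1] at hq1
  have hup1 : (conj (Y 1 1) * Y.det).re ≤ ‖Y 1 1‖ * D := by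
    have := Complex.re_le_norm (conj (Y 1 1) * Y.det)
    rwa [norm_mul, Complex.norm_conj] at this
  rw [norm_neg] at hq1
  obtain ⟨h11, h10⟩ := step ‖Y 1 1‖ ‖Y 1 0‖ (norm_nonneg _) (norm_nonneg _) (hq1.trans hup1)
  -- column `u′ = (−Y₀₁, Y₀₀)`: `Y u′ = (0, det Y)`
  have hcol2 : conj (-Y 0 1) * (Y 0 0 * (-Y 0 1) + Y 0 1 * Y 0 0) + conj (Y 0 0) * (Y 1 0 * (-Y 0 1) + Y 1 1 * Y 0 0) = conj (Y 0 0) * Y.det := by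
    rw [hdet]; ring
  have hq2 := quadForm_lower_bound hp hw (-Y 0 1) (Y 0 0)
  have hre2 := re_inner_sub_I_smul d c (-Y 0 1) (Y 0 0)
  rw [← hY] at hre2
  rw [← hre2, hcol2] at hq2
  have hup2 : (conj (Y 0 0) * Y.det).re ≤ ‖Y 0 0‖ * D := by
    have := Complex.re_le_norm (conj (Y 0 0) * Y.det)
    rwa [norm_mul, Complex.norm_conj] at this
  rw [norm_neg, add_comm (‖Y 0 1‖ ^ 2) (‖Y 0 0‖ ^ 2)] at hq2
  obtain ⟨h00, h01⟩ := step ‖Y 0 0‖ ‖Y 0 1‖ (norm_nonneg _) (norm_nonneg _) (hq2.trans hup2)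
  fin_cases i <;> fin_cases j
  · exact h00
  · exact h01
  · exact h10
  · exact h11

/-- **THE ENTRY BOUND FOR `g − ix`, `g > 0`**: there is `C > 0` (namely `tr g ∕ det g`) with `‖(g − ix)_{kl}‖ ≤ C·|det(g − ix)|` for every Hermitian `x`
and all `k, l`. [folklore] -/
theorem exists_norm_entry_le_sub {g : Matrix (Fin 2) (Fin 2) ℂ} (hg : g.PosDef) :
    ∃ C : ℝ, 0 < C ∧ ∀ (c : ℝ × ℂ × ℝ) (i j : Fin 2), ‖(g - I • hermTwo c) i j‖ ≤ C * ‖(g - I • hermTwo c).det‖ := by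
  obtain ⟨d, rfl⟩ : ∃ d : ℝ × ℂ × ℝ, hermTwo d = g := ⟨_, hermTwo_eq_of_isHermitian hg.1⟩
  have hd := (posDef_hermTwo_iff d).mp hg
  have hq : 0 < d.2.2 := (mul_pos_iff_of_pos_left hd.1).mp (lt_of_le_of_lt (normSq_nonneg _) hd.2)
  exact ⟨(d.1 + d.2.2) / (d.1 * d.2.2 - normSq d.2.1), div_pos (by linarith [hd.1]) (by linarith [hd.2]),
    fun c i j => norm_entry_le_mul_norm_det_hermTwo d hd c i j⟩

/-- `(g + ix)_{kl} = conj (g − ix)_{lk}` for Hermitian `g` and `x = hermTwo c`. [folklore] -/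
theorem add_I_smul_apply_eq_conj {g : Matrix (Fin 2) (Fin 2) ℂ} (hg : g.IsHermitian) (c : ℝ × ℂ × ℝ) (i j : Fin 2) :
    (g + I • hermTwo c) i j = conj ((g - I • hermTwo c) j i) := by
  have h1 : conj (g j i) = g i j := hg.apply i j
  have h2 : conj (hermTwo c j i) = hermTwo c i j := (isHermitian_hermTwo c).apply i j
  simp only [Matrix.add_apply, Matrix.sub_apply, Matrix.smul_apply, smul_eq_mul, map_sub, map_mul, Complex.conj_I, h1, h2]
  ring

/-- **THE ENTRY BOUND FOR `g + ix`, `g > 0`** (conjugate of §1; `|det(g + ix)| = |det(g − ix)|`). [folklore] -/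
theorem exists_norm_entry_le_add {g : Matrix (Fin 2) (Fin 2) ℂ} (hg : g.PosDef) :
    ∃ C : ℝ, 0 < C ∧ ∀ (c : ℝ × ℂ × ℝ) (i j : Fin 2), ‖(g + I • hermTwo c) i j‖ ≤ C * ‖(g + I • hermTwo c).det‖ := by
  obtain ⟨C, hC, hle⟩ := exists_norm_entry_le_sub hg
  refine ⟨C, hC, fun c i j => ?_⟩
  have hdet : ‖(g + I • hermTwo c).det‖ = ‖(g - I • hermTwo c).det‖ := by
    rw [det_sub_I_smul_eq_conj hg c, Complex.norm_conj]
  rw [add_I_smul_apply_eq_conj hg.1 c i j, Complex.norm_conj, hdet]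
  exact hle c j i

/-! ## §2 Polarisation coefficients and index shifts, with the character -/

/-- `tr(adj(A)·M) = A₁₁M₀₀ − A₀₁M₁₀ − A₁₀M₀₁ + A₀₀M₁₁` (dimension two). [folklore] -/
theorem trace_adjugate_mul_fin_two (A M : Matrix (Fin 2) (Fin 2) ℂ) :
    (A.adjugate * M).trace = A 1 1 * M 0 0 - A 0 1 * M 1 0 - A 1 0 * M 0 1 + A 0 0 * M 1 1 := by
  simp only [Matrix.adjugate_fin_two, Matrix.trace_fin_two, Matrix.mul_apply, Fin.sum_univ_two, Matrix.of_apply, Matrix.cons_val',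
    Matrix.cons_val_zero, Matrix.cons_val_one, Matrix.empty_val', Matrix.cons_val_fin_one]
  ring

/-- **POLARISATION BOUND**: if `‖A_{kl}‖ ≤ K` for all `k, l` then `‖tr(adj(A)·M)‖ ≤ K·(‖M₀₀‖ + ‖M₀₁‖ + ‖M₁₀‖ + ‖M₁₁‖)`. [folklore] -/
theorem norm_trace_adjugate_mul_le (A M : Matrix (Fin 2) (Fin 2) ℂ) {K : ℝ} (hA : ∀ i j, ‖A i j‖ ≤ K) :
    ‖(A.adjugate * M).trace‖ ≤ K * (‖M 0 0‖ + ‖M 0 1‖ + ‖M 1 0‖ + ‖M 1 1‖) := by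
  have hK : 0 ≤ K := (norm_nonneg _).trans (hA 0 0)
  rw [trace_adjugate_mul_fin_two]
  have h1 : ‖A 1 1 * M 0 0‖ ≤ K * ‖M 0 0‖ := by rw [norm_mul]; exact mul_le_mul_of_nonneg_right (hA 1 1) (norm_nonneg _)
  have h2 : ‖A 0 1 * M 1 0‖ ≤ K * ‖M 1 0‖ := by rw [norm_mul]; exact mul_le_mul_of_nonneg_right (hA 0 1) (norm_nonneg _)
  have h3 : ‖A 1 0 * M 0 1‖ ≤ K * ‖M 0 1‖ := by rw [norm_mul]; exact mul_le_mul_of_nonneg_right (hA 1 0) (norm_nonneg _)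
  have h4 : ‖A 0 0 * M 1 1‖ ≤ K * ‖M 1 1‖ := by rw [norm_mul]; exact mul_le_mul_of_nonneg_right (hA 0 0) (norm_nonneg _)
  have n1 := norm_add_le (A 1 1 * M 0 0 - A 0 1 * M 1 0 - A 1 0 * M 0 1) (A 0 0 * M 1 1)
  have n2 := norm_sub_le (A 1 1 * M 0 0 - A 0 1 * M 1 0) (A 1 0 * M 0 1)
  have n3 := norm_sub_le (A 1 1 * M 0 0) (A 0 1 * M 1 0)
  calc ‖A 1 1 * M 0 0 - A 0 1 * M 1 0 - A 1 0 * M 0 1 + A 0 0 * M 1 1‖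
      ≤ ‖A 1 1 * M 0 0‖ + ‖A 0 1 * M 1 0‖ + ‖A 1 0 * M 0 1‖ + ‖A 0 0 * M 1 1‖ := by linarith
    _ ≤ K * ‖M 0 0‖ + K * ‖M 1 0‖ + K * ‖M 0 1‖ + K * ‖M 1 1‖ := by linarith
    _ = K * (‖M 0 0‖ + ‖M 0 1‖ + ‖M 1 0‖ + ‖M 1 1‖) := by ring

/-- The polarisation coefficient `c ↦ tr(adj(g − ix_c)·M)` is continuous (a polynomial in the chart). -/
theorem continuous_trace_adjugate_sub_mul (g M : Matrix (Fin 2) (Fin 2) ℂ) :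
    Continuous fun c : ℝ × ℂ × ℝ => ((g - I • hermTwo c).adjugate * M).trace := by
  have h : (fun c : ℝ × ℂ × ℝ => ((g - I • hermTwo c).adjugate * M).trace) = fun c =>
      (g 1 1 - I * (c.2.2 : ℂ)) * M 0 0 - (g 0 1 - I * c.2.1) * M 1 0 - (g 1 0 - I * conj c.2.1) * M 0 1 + (g 0 0 - I * (c.1 : ℂ)) * M 1 1 := by
    funext c
    rw [trace_adjugate_mul_fin_two]
    simp [hermTwo]
  rw [h]
  fun_prop

/-- The polarisation coefficient `c ↦ tr(adj(g + ix_c)·M)` is continuous. -/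
theorem continuous_trace_adjugate_add_mul (g M : Matrix (Fin 2) (Fin 2) ℂ) :
    Continuous fun c : ℝ × ℂ × ℝ => ((g + I • hermTwo c).adjugate * M).trace := by
  have h : (fun c : ℝ × ℂ × ℝ => ((g + I • hermTwo c).adjugate * M).trace) = fun c =>
      (g 1 1 + I * (c.2.2 : ℂ)) * M 0 0 - (g 0 1 + I * c.2.1) * M 1 0 - (g 1 0 + I * conj c.2.1) * M 0 1 + (g 0 0 + I * (c.1 : ℂ)) * M 1 1 := by
    funext c
    rw [trace_adjugate_mul_fin_two]
    simp [hermTwo]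
  rw [h]
  fun_prop

/-- INDEX SHIFT WITH THE CHARACTER: `xiTwoIntegrand g h (α+1) β = −det(g − ix)⁻¹ · xiTwoIntegrand g h α β` (`g > 0`, any `h`). -/
theorem xiTwoIntegrand_succ_left {g : Matrix (Fin 2) (Fin 2) ℂ} (hg : g.PosDef) (h : Matrix (Fin 2) (Fin 2) ℂ) (α β : ℂ) (c : ℝ × ℂ × ℝ) :
    xiTwoIntegrand g h (α + 1) β c = -(((g - I • hermTwo c).det)⁻¹ * xiTwoIntegrand g h α β c) := by
  rw [xiTwoIntegrand_eq_cexp_mul_zero, xiTwoIntegrand_eq_cexp_mul_zero g h α β c, xiTwoIntegrand_zero_succ_left hg]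
  ring

/-- INDEX SHIFT WITH THE CHARACTER: `xiTwoIntegrand g h α (β+1) = −det(g + ix)⁻¹ · xiTwoIntegrand g h α β` (`g > 0`, any `h`). -/
theorem xiTwoIntegrand_succ_right {g : Matrix (Fin 2) (Fin 2) ℂ} (hg : g.PosDef) (h : Matrix (Fin 2) (Fin 2) ℂ) (α β : ℂ) (c : ℝ × ℂ × ℝ) :
    xiTwoIntegrand g h α (β + 1) c = -(((g + I • hermTwo c).det)⁻¹ * xiTwoIntegrand g h α β c) := by
  rw [xiTwoIntegrand_eq_cexp_mul_zero, xiTwoIntegrand_eq_cexp_mul_zero g h α β c, xiTwoIntegrand_zero_succ_right hg]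
  ring

/-- `‖xiTwoIntegrand g h (α+1) β‖ = |det(g − ix)|⁻¹ · ‖xiTwoIntegrand g h α β‖`. -/
theorem norm_xiTwoIntegrand_succ_left {g : Matrix (Fin 2) (Fin 2) ℂ} (hg : g.PosDef) (h : Matrix (Fin 2) (Fin 2) ℂ) (α β : ℂ) (c : ℝ × ℂ × ℝ) :
    ‖xiTwoIntegrand g h (α + 1) β c‖ = ‖(g - I • hermTwo c).det‖⁻¹ * ‖xiTwoIntegrand g h α β c‖ := by
  rw [xiTwoIntegrand_succ_left hg, norm_neg, norm_mul, norm_inv]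

/-- `‖xiTwoIntegrand g h α (β+1)‖ = |det(g + ix)|⁻¹ · ‖xiTwoIntegrand g h α β‖`. -/
theorem norm_xiTwoIntegrand_succ_right {g : Matrix (Fin 2) (Fin 2) ℂ} (hg : g.PosDef) (h : Matrix (Fin 2) (Fin 2) ℂ) (α β : ℂ) (c : ℝ × ℂ × ℝ) :
    ‖xiTwoIntegrand g h α (β + 1) c‖ = ‖(g + I • hermTwo c).det‖⁻¹ * ‖xiTwoIntegrand g h α β c‖ := by
  rw [xiTwoIntegrand_succ_right hg, norm_neg, norm_mul, norm_inv]

/-! ## §3 Integrability of every integration-by-parts term, by the one majorant `‖ξ-integrand(α, β)‖` -/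

/-- THE MAJORANT PRINCIPLE: a measurable `F` with `‖F‖ ≤ K·‖xiTwoIntegrand g h α β‖` is integrable (`g > 0`, `h` Hermitian, `re(α+β) > 3`;
★ `integrable_xiTwoIntegrand`). -/
theorem integrable_of_norm_le_mul {g h : Matrix (Fin 2) (Fin 2) ℂ} (hg : g.PosDef) (hh : h.IsHermitian) {α β : ℂ} (hαβ : 3 < (α + β).re)
    {F : ℝ × ℂ × ℝ → ℂ} (hF : AEStronglyMeasurable F (volume : Measure (ℝ × ℂ × ℝ))) {K : ℝ}
    (hle : ∀ c, ‖F c‖ ≤ K * ‖xiTwoIntegrand g h α β c‖) : Integrable F :=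
  Integrable.mono' (((integrable_xiTwoIntegrand hg hh hαβ).norm).const_mul K) hF (Filter.Eventually.of_forall hle)

/-- **(G1)** `tr(adj(g − ix)·M) · ξ-integrand(α+1, β)` is integrable. [cite: Shimura1982, §3] -/
theorem integrable_polY_mul_succ_left {g h : Matrix (Fin 2) (Fin 2) ℂ} (hg : g.PosDef) (hh : h.IsHermitian) {α β : ℂ} (hαβ : 3 < (α + β).re)
    (M : Matrix (Fin 2) (Fin 2) ℂ) :
    Integrable (fun c : ℝ × ℂ × ℝ => ((g - I • hermTwo c).adjugate * M).trace * xiTwoIntegrand g h (α + 1) β c) := by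
  obtain ⟨C, hC, hle⟩ := exists_norm_entry_le_sub hg
  refine integrable_of_norm_le_mul hg hh hαβ
    (((continuous_trace_adjugate_sub_mul g M).measurable.mul (measurable_xiTwoIntegrand g h (α + 1) β)).aestronglyMeasurable)
    (K := C * (‖M 0 0‖ + ‖M 0 1‖ + ‖M 1 0‖ + ‖M 1 1‖)) fun c => ?_
  have hP : 0 < ‖(g - I • hermTwo c).det‖ := norm_pos_iff.mpr (det_sub_I_smul_hermTwo_ne_zero hg c)
  have hpol := norm_trace_adjugate_mul_le (g - I • hermTwo c) M (fun i j => hle c i j)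
  rw [norm_mul, norm_xiTwoIntegrand_succ_left hg]
  have hS : 0 ≤ ‖M 0 0‖ + ‖M 0 1‖ + ‖M 1 0‖ + ‖M 1 1‖ := by positivity
  calc ‖((g - I • hermTwo c).adjugate * M).trace‖ * (‖(g - I • hermTwo c).det‖⁻¹ * ‖xiTwoIntegrand g h α β c‖)
      ≤ (C * ‖(g - I • hermTwo c).det‖ * (‖M 0 0‖ + ‖M 0 1‖ + ‖M 1 0‖ + ‖M 1 1‖)) *
          (‖(g - I • hermTwo c).det‖⁻¹ * ‖xiTwoIntegrand g h α β c‖) := mul_le_mul_of_nonneg_right hpol (by positivity)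
    _ = C * (‖M 0 0‖ + ‖M 0 1‖ + ‖M 1 0‖ + ‖M 1 1‖) * ‖xiTwoIntegrand g h α β c‖ := by field_simp

/-- **(G2)** `tr(adj(g + ix)·M) · ξ-integrand(α, β+1)` is integrable. [cite: Shimura1982, §3] -/
theorem integrable_polW_mul_succ_right {g h : Matrix (Fin 2) (Fin 2) ℂ} (hg : g.PosDef) (hh : h.IsHermitian) {α β : ℂ} (hαβ : 3 < (α + β).re)
    (M : Matrix (Fin 2) (Fin 2) ℂ) :
    Integrable (fun c : ℝ × ℂ × ℝ => ((g + I • hermTwo c).adjugate * M).trace * xiTwoIntegrand g h α (β + 1) c) := by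
  obtain ⟨C, hC, hle⟩ := exists_norm_entry_le_add hg
  refine integrable_of_norm_le_mul hg hh hαβ
    (((continuous_trace_adjugate_add_mul g M).measurable.mul (measurable_xiTwoIntegrand g h α (β + 1))).aestronglyMeasurable)
    (K := C * (‖M 0 0‖ + ‖M 0 1‖ + ‖M 1 0‖ + ‖M 1 1‖)) fun c => ?_
  have hQ : 0 < ‖(g + I • hermTwo c).det‖ := norm_det_add_I_smul_pos hg c
  have hpol := norm_trace_adjugate_mul_le (g + I • hermTwo c) M (fun i j => hle c i j)
  rw [norm_mul, norm_xiTwoIntegrand_succ_right hg]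
  have hS : 0 ≤ ‖M 0 0‖ + ‖M 0 1‖ + ‖M 1 0‖ + ‖M 1 1‖ := by positivity
  calc ‖((g + I • hermTwo c).adjugate * M).trace‖ * (‖(g + I • hermTwo c).det‖⁻¹ * ‖xiTwoIntegrand g h α β c‖)
      ≤ (C * ‖(g + I • hermTwo c).det‖ * (‖M 0 0‖ + ‖M 0 1‖ + ‖M 1 0‖ + ‖M 1 1‖)) *
          (‖(g + I • hermTwo c).det‖⁻¹ * ‖xiTwoIntegrand g h α β c‖) := mul_le_mul_of_nonneg_right hpol (by positivity)
    _ = C * (‖M 0 0‖ + ‖M 0 1‖ + ‖M 1 0‖ + ‖M 1 1‖) * ‖xiTwoIntegrand g h α β c‖ := by field_simp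

/-- **(G3)** `tr(adj(g − ix)·M)·tr(adj(g − ix)·M′) · ξ-integrand(α+2, β)` is integrable. [cite: Shimura1982, §3] -/
theorem integrable_polY_polY_mul {g h : Matrix (Fin 2) (Fin 2) ℂ} (hg : g.PosDef) (hh : h.IsHermitian) {α β : ℂ} (hαβ : 3 < (α + β).re)
    (M M' : Matrix (Fin 2) (Fin 2) ℂ) :
    Integrable (fun c : ℝ × ℂ × ℝ => ((g - I • hermTwo c).adjugate * M).trace * ((g - I • hermTwo c).adjugate * M').trace *
      xiTwoIntegrand g h (α + 1 + 1) β c) := by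
  obtain ⟨C, hC, hle⟩ := exists_norm_entry_le_sub hg
  refine integrable_of_norm_le_mul hg hh hαβ
    ((((continuous_trace_adjugate_sub_mul g M).mul (continuous_trace_adjugate_sub_mul g M')).measurable.mul
      (measurable_xiTwoIntegrand g h (α + 1 + 1) β)).aestronglyMeasurable)
    (K := C * (‖M 0 0‖ + ‖M 0 1‖ + ‖M 1 0‖ + ‖M 1 1‖) * (C * (‖M' 0 0‖ + ‖M' 0 1‖ + ‖M' 1 0‖ + ‖M' 1 1‖))) fun c => ?_
  have hP : 0 < ‖(g - I • hermTwo c).det‖ := norm_pos_iff.mpr (det_sub_I_smul_hermTwo_ne_zero hg c)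
  have hpol := norm_trace_adjugate_mul_le (g - I • hermTwo c) M (fun i j => hle c i j)
  have hpol' := norm_trace_adjugate_mul_le (g - I • hermTwo c) M' (fun i j => hle c i j)
  rw [norm_mul, norm_mul, norm_xiTwoIntegrand_succ_left hg, norm_xiTwoIntegrand_succ_left hg]
  have hS : 0 ≤ ‖M 0 0‖ + ‖M 0 1‖ + ‖M 1 0‖ + ‖M 1 1‖ := by positivity
  have hS' : 0 ≤ ‖M' 0 0‖ + ‖M' 0 1‖ + ‖M' 1 0‖ + ‖M' 1 1‖ := by positivity
  calc ‖((g - I • hermTwo c).adjugate * M).trace‖ * ‖((g - I • hermTwo c).adjugate * M').trace‖ *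
        (‖(g - I • hermTwo c).det‖⁻¹ * (‖(g - I • hermTwo c).det‖⁻¹ * ‖xiTwoIntegrand g h α β c‖))
      ≤ (C * ‖(g - I • hermTwo c).det‖ * (‖M 0 0‖ + ‖M 0 1‖ + ‖M 1 0‖ + ‖M 1 1‖)) *
          (C * ‖(g - I • hermTwo c).det‖ * (‖M' 0 0‖ + ‖M' 0 1‖ + ‖M' 1 0‖ + ‖M' 1 1‖)) *
          (‖(g - I • hermTwo c).det‖⁻¹ * (‖(g - I • hermTwo c).det‖⁻¹ * ‖xiTwoIntegrand g h α β c‖)) :=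
        mul_le_mul_of_nonneg_right (mul_le_mul hpol hpol' (norm_nonneg _) (by positivity)) (by positivity)
    _ = C * (‖M 0 0‖ + ‖M 0 1‖ + ‖M 1 0‖ + ‖M 1 1‖) * (C * (‖M' 0 0‖ + ‖M' 0 1‖ + ‖M' 1 0‖ + ‖M' 1 1‖)) * ‖xiTwoIntegrand g h α β c‖ := by
        field_simp

/-- **(G4)** `tr(adj(g − ix)·M)·tr(adj(g + ix)·M′) · ξ-integrand(α+1, β+1)` is integrable. [cite: Shimura1982, §3] -/
theorem integrable_polY_polW_mul {g h : Matrix (Fin 2) (Fin 2) ℂ} (hg : g.PosDef) (hh : h.IsHermitian) {α β : ℂ} (hαβ : 3 < (α + β).re)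
    (M M' : Matrix (Fin 2) (Fin 2) ℂ) :
    Integrable (fun c : ℝ × ℂ × ℝ => ((g - I • hermTwo c).adjugate * M).trace * ((g + I • hermTwo c).adjugate * M').trace *
      xiTwoIntegrand g h (α + 1) (β + 1) c) := by
  obtain ⟨C, hC, hle⟩ := exists_norm_entry_le_sub hg
  obtain ⟨C', hC', hle'⟩ := exists_norm_entry_le_add hg
  refine integrable_of_norm_le_mul hg hh hαβ
    ((((continuous_trace_adjugate_sub_mul g M).mul (continuous_trace_adjugate_add_mul g M')).measurable.mul
      (measurable_xiTwoIntegrand g h (α + 1) (β + 1))).aestronglyMeasurable)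
    (K := C * (‖M 0 0‖ + ‖M 0 1‖ + ‖M 1 0‖ + ‖M 1 1‖) * (C' * (‖M' 0 0‖ + ‖M' 0 1‖ + ‖M' 1 0‖ + ‖M' 1 1‖))) fun c => ?_
  have hP : 0 < ‖(g - I • hermTwo c).det‖ := norm_pos_iff.mpr (det_sub_I_smul_hermTwo_ne_zero hg c)
  have hQ : 0 < ‖(g + I • hermTwo c).det‖ := norm_det_add_I_smul_pos hg c
  have hpol := norm_trace_adjugate_mul_le (g - I • hermTwo c) M (fun i j => hle c i j)
  have hpol' := norm_trace_adjugate_mul_le (g + I • hermTwo c) M' (fun i j => hle' c i j)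
  rw [norm_mul, norm_mul, norm_xiTwoIntegrand_succ_left hg, norm_xiTwoIntegrand_succ_right hg]
  have hS : 0 ≤ ‖M 0 0‖ + ‖M 0 1‖ + ‖M 1 0‖ + ‖M 1 1‖ := by positivity
  have hS' : 0 ≤ ‖M' 0 0‖ + ‖M' 0 1‖ + ‖M' 1 0‖ + ‖M' 1 1‖ := by positivity
  calc ‖((g - I • hermTwo c).adjugate * M).trace‖ * ‖((g + I • hermTwo c).adjugate * M').trace‖ *
        (‖(g - I • hermTwo c).det‖⁻¹ * (‖(g + I • hermTwo c).det‖⁻¹ * ‖xiTwoIntegrand g h α β c‖))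
      ≤ (C * ‖(g - I • hermTwo c).det‖ * (‖M 0 0‖ + ‖M 0 1‖ + ‖M 1 0‖ + ‖M 1 1‖)) *
          (C' * ‖(g + I • hermTwo c).det‖ * (‖M' 0 0‖ + ‖M' 0 1‖ + ‖M' 1 0‖ + ‖M' 1 1‖)) *
          (‖(g - I • hermTwo c).det‖⁻¹ * (‖(g + I • hermTwo c).det‖⁻¹ * ‖xiTwoIntegrand g h α β c‖)) :=
        mul_le_mul_of_nonneg_right (mul_le_mul hpol hpol' (norm_nonneg _) (by positivity)) (by positivity)
    _ = C * (‖M 0 0‖ + ‖M 0 1‖ + ‖M 1 0‖ + ‖M 1 1‖) * (C' * (‖M' 0 0‖ + ‖M' 0 1‖ + ‖M' 1 0‖ + ‖M' 1 1‖)) * ‖xiTwoIntegrand g h α β c‖ := by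
        field_simp

/-- **(G5)** `tr(adj(g + ix)·M)·tr(adj(g + ix)·M′) · ξ-integrand(α, β+2)` is integrable. [cite: Shimura1982, §3] -/
theorem integrable_polW_polW_mul {g h : Matrix (Fin 2) (Fin 2) ℂ} (hg : g.PosDef) (hh : h.IsHermitian) {α β : ℂ} (hαβ : 3 < (α + β).re)
    (M M' : Matrix (Fin 2) (Fin 2) ℂ) :
    Integrable (fun c : ℝ × ℂ × ℝ => ((g + I • hermTwo c).adjugate * M).trace * ((g + I • hermTwo c).adjugate * M').trace *
      xiTwoIntegrand g h α (β + 1 + 1) c) := by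
  obtain ⟨C, hC, hle⟩ := exists_norm_entry_le_add hg
  refine integrable_of_norm_le_mul hg hh hαβ
    ((((continuous_trace_adjugate_add_mul g M).mul (continuous_trace_adjugate_add_mul g M')).measurable.mul
      (measurable_xiTwoIntegrand g h α (β + 1 + 1))).aestronglyMeasurable)
    (K := C * (‖M 0 0‖ + ‖M 0 1‖ + ‖M 1 0‖ + ‖M 1 1‖) * (C * (‖M' 0 0‖ + ‖M' 0 1‖ + ‖M' 1 0‖ + ‖M' 1 1‖))) fun c => ?_
  have hQ : 0 < ‖(g + I • hermTwo c).det‖ := norm_det_add_I_smul_pos hg c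
  have hpol := norm_trace_adjugate_mul_le (g + I • hermTwo c) M (fun i j => hle c i j)
  have hpol' := norm_trace_adjugate_mul_le (g + I • hermTwo c) M' (fun i j => hle c i j)
  rw [norm_mul, norm_mul, norm_xiTwoIntegrand_succ_right hg, norm_xiTwoIntegrand_succ_right hg]
  have hS : 0 ≤ ‖M 0 0‖ + ‖M 0 1‖ + ‖M 1 0‖ + ‖M 1 1‖ := by positivity
  have hS' : 0 ≤ ‖M' 0 0‖ + ‖M' 0 1‖ + ‖M' 1 0‖ + ‖M' 1 1‖ := by positivity
  calc ‖((g + I • hermTwo c).adjugate * M).trace‖ * ‖((g + I • hermTwo c).adjugate * M').trace‖ *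
        (‖(g + I • hermTwo c).det‖⁻¹ * (‖(g + I • hermTwo c).det‖⁻¹ * ‖xiTwoIntegrand g h α β c‖))
      ≤ (C * ‖(g + I • hermTwo c).det‖ * (‖M 0 0‖ + ‖M 0 1‖ + ‖M 1 0‖ + ‖M 1 1‖)) *
          (C * ‖(g + I • hermTwo c).det‖ * (‖M' 0 0‖ + ‖M' 0 1‖ + ‖M' 1 0‖ + ‖M' 1 1‖)) *
          (‖(g + I • hermTwo c).det‖⁻¹ * (‖(g + I • hermTwo c).det‖⁻¹ * ‖xiTwoIntegrand g h α β c‖)) :=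
        mul_le_mul_of_nonneg_right (mul_le_mul hpol hpol' (norm_nonneg _) (by positivity)) (by positivity)
    _ = C * (‖M 0 0‖ + ‖M 0 1‖ + ‖M 1 0‖ + ‖M 1 1‖) * (C * (‖M' 0 0‖ + ‖M' 0 1‖ + ‖M' 1 0‖ + ‖M' 1 1‖)) * ‖xiTwoIntegrand g h α β c‖ := by
        field_simp

end Summit.HodgeConjecture.HodgeConjecture.Cruxes.HLiu418.K2LiuHermTwoXiCayleyIntegrability

end
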